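import Summits.BirchSwinnertonDyer.Rank1Residual.X11b.Three.GoodReductionSubgroupNodeH1Nonsplit
import Summits.BirchSwinnertonDyer.Rank1Residual.X11b.Three.MultiplicativeNodePresentation
import Summits.BirchSwinnertonDyer.Rank1Residual.X11b.Three.GoodReductionSubgroupFormalH1
import Mathlib.RingTheory.RootsOfUnity.AlgebraicallyClosed
import Mathlib.FieldTheory.IsAlgClosed.AlgebraicClosure
import HarnessLib

/-!
# X11b at `p = 3` (team N8/O2), JET3-KUMMER (α): the `Ẽ_ns` half at a NON-SPLIT multiplicative
# place in Mathlib's reduction-class currency (`HasMultiplicativeReduction ∧ ¬ HasSplit…`), the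
# auxiliary field `k' = k̄`, the Frobenius `Fq` and the root of unity `ζ` DISCHARGED

HONEST FRAMING (cell `b2b-bsdres`, run/shared/lean/b2b/bsd-rank1-residual/, verbatim in every
file): the goal of the cell is to DELETE the COMBINATION-SHAPED residual classes of the
Birch–Swinnerton-Dyer formula for ALL analytic-rank `≤ 1` elliptic curves over `ℚ` — "full BSD
formula for every rank `≤ 1` curve in class `C`" assembled STRICTLY from published theorems — so
that the rank-`≤ 1` remainder becomes exactly the CONSTRUCTION-SHAPED classes, which are TYPED
(missing-input `Prop`s), NOT attempted. This is not "finishing BSD". Team N8/O2 = `x11b3`, seat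
`b2b-bsdres-x11b3-p3` (GEN 3), LEAD DEAL #7 (R7-7), sub-target S15 (ii) "the non-split node with
`[k : k_v]` odd", part 4 (discharge form, the non-split twin of x11b3-p8's
`MultiplicativeNodePresentation` §4). THEOREMS ONLY: no definition, no named fact, no `sorry`;
nothing is booked; the flag `JET@p|N` is NOT discharged; `h1ker` stays a NAMED STUB here
(x11b3-p4 proves it separately, S15 (i)).

## What

`GoodReductionSubgroupNodeH1Nonsplit.h1red_of_nonsplit_node` takes the presentation of the node
over an auxiliary field `k' ⊇ k` (`j`, `hW`, `α₁ ∉ j(k)`), the `q`-power ring endomorphism `Fq` of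
`k'` and a primitive `(qⁿ + 1)`-th root of unity `ζ ∈ k'` as data. Here all of it is DISCHARGED
with `k' = k̄ = AlgebraicClosure k`:

* §1 `exists_frobenius_and_primitiveRoot_algebraicClosure` — for a finite field `k` with
  `#k = qⁿ`: `q = p^f` is a power of the characteristic (`Nat.eq_prime_pow_of_unique_prime_dvd`),
  so `x ↦ x^q` is the ring endomorphism `iterateFrobenius k̄ p f`; and `qⁿ + 1 = 1 ≠ 0` in `k`, so
  `k̄` has a primitive `(qⁿ + 1)`-th root of unity (Mathlib `HasEnoughRootsOfUnity`).
* §2 `h1red_of_not_hasSplitMultiplicativeReduction`, `hα_of_h1ker_of_not_hasSplitMultiplicativeReduction`,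
  `exists_baseChange_eq_add_pow_smul_of_h1ker_of_not_hasSplitMultiplicativeReduction` — p4's three
  node theorems at a NON-SPLIT multiplicative place, hypotheses
  `[(X.baseChange L).HasMultiplicativeReduction R]` + `¬ (X.baseChange L).HasSplitMultiplicativeReduction R`
  (+ `hR`, `hcard`, `hfrob`, and for (α) `hφ`, `hn`, the stub `h1ker`): the splitting quadratic has a
  root in `k̄` (`IsAlgClosed.exists_root`; degree `2` as `c̄₄ ≠ 0`), p8's
  `exists_map_map_residue_eq_singularModel_of_hasMultiplicativeReduction` presents the node over
  `k̄`, `not_mem_range_of_not_splits` (part 1 §0) gives `α₁ ∉ k`, and §1 supplies `Fq`, `ζ`.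

* §3 `hα_of_not_hasSplitMultiplicativeReduction_of_complete`,
  `exists_baseChange_eq_add_pow_smul_of_not_hasSplitMultiplicativeReduction_of_complete` — over
  the COMPLETE layer (`R` the valuation ring of a rank-one valuation `w` on `L`, `IsAdicComplete`,
  `X ⊗ L` elliptic, `φ` isometric, a uniformiser from `F`) the stub `h1ker` is x11b3-p4's THEOREM
  `h1ker_of_complete` (`GoodReductionSubgroupFormalH1`, S15 (i)), so **(α) HOLDS — no stub — at
  every NON-SPLIT multiplicative place** (the twin of p4's `hα_of_node_of_complete`).

With p8's §4 (`…_of_hasSplitMultiplicativeReduction`) this covers EVERY multiplicative place —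
whatever the parity of `[k : k_v]` — modulo the residual inputs of record S15 (iii)(b/c) (`#k = qⁿ`,
`φ` inducing `x ↦ x^q`, `Gal(L/F) = ⟨φ⟩`, `φⁿ = 1`, `hR`; in §3 also `hφw`, `hϖ`, `hπ`).

References (locators only; no new fact): [cite: SilvermanAEC2009, VII.2 Prop. 2.1 (PDF p. 167),
Exercise 3.5(a) (PDF p. 97), VII.§5 (PDF p. 174)] [cite: MilneADT2006, Ch. I Prop. 3.8]
[cite: SerreLocalFields1979, X §1 (Hilbert 90)] [cite: Jetchev2008, Prop. 4.1 (p. 819)].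

## Relation to x11b3-p4's parts 9–10 (option (B), inflation)

`GoodReductionSubgroupInflation` / `GoodReductionSubgroupNonsplitOdd` (`hα_of_nonsplit_odd`)
reach the same end claim (α) at a non-split node with `[k : k_v]` odd by INFLATION, GIVEN the
quadratic unramified FIELD layer `L' ⊇ L ⊇ F` with its own `R'`, `w'`, Frobenius data `φ'`
restricting to `φ` and `Fix(φ'ⁿ) = L`. The present route (option (A), design note
`S15ii-NONSPLIT-NODE-DESIGN.md`) uses NO auxiliary field layer: the twisted torus is handled
directly at the RESIDUE level (`j : k → k' = k̄` chosen inside the proof), so §3's residual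
hypotheses are literally those of p4's split-node `hα_of_node_of_complete` plus
`¬ HasSplitMultiplicativeReduction`. The two derivations are independent cross-checks.

## Design

No definitions; `k' := AlgebraicClosure (IsLocalRing.ResidueField R)` chosen inside the proofs.
Axioms: `propext`, `Classical.choice`, `Quot.sound`.
-/

noncomputable section

open scoped Classical

namespace Summit.BirchSwinnertonDyer.Rank1Residual.X11b.Three.JetchevKummer

open WeierstrassCurve Literature.NumberTheory.EllipticCurves

universe u

/-! ### §1 Finite fields: `x ↦ x^q` and a primitive `(qⁿ+1)`-th root of unity in `k̄` -/

/-- For a finite field `k` of order `qⁿ`: on `k̄` the `q`-power map is a ring endomorphism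
(`q = p^f`, `p` the characteristic) and `k̄` contains a primitive `(qⁿ + 1)`-th root of unity
(`qⁿ + 1 ≡ 1` is non-zero in `k`). [folklore] -/
theorem exists_frobenius_and_primitiveRoot_algebraicClosure {k : Type*} [Field k] [Fintype k]
    {q n : ℕ} (hcard : Fintype.card k = q ^ n) :
    (∃ Fq : AlgebraicClosure k →+* AlgebraicClosure k, ∀ x, Fq x = x ^ q) ∧
      ∃ ζ : (AlgebraicClosure k)ˣ, IsPrimitiveRoot ζ (q ^ n + 1) := by
  obtain ⟨p, hchar, d, hp, hcardp⟩ := FiniteField.card' k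
  haveI := hchar
  have hn0 : n ≠ 0 := by
    rintro rfl
    rw [pow_zero] at hcard
    exact (Fintype.one_lt_card (α := k)).ne' hcard
  have hq0 : q ≠ 0 := by
    rintro rfl
    rw [zero_pow hn0] at hcard
    exact Fintype.card_ne_zero hcard
  -- `q` is a power of the characteristic
  have hq : q = p ^ q.primeFactorsList.length := by
    refine Nat.eq_prime_pow_of_unique_prime_dvd hq0 (fun {r} hr hrq ↦ ?_)
    have h1 : r ∣ p ^ (d : ℕ) := by
      rw [← hcardp, hcard]; exact hrq.trans (dvd_pow_self q hn0)
    exact (Nat.prime_dvd_prime_iff_eq hr hp).mp (hr.dvd_of_dvd_pow h1)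
  haveI : CharP (AlgebraicClosure k) p :=
    charP_of_injective_algebraMap (algebraMap k (AlgebraicClosure k)).injective p
  haveI : ExpChar (AlgebraicClosure k) p := ExpChar.prime hp
  refine ⟨⟨iterateFrobenius (AlgebraicClosure k) p q.primeFactorsList.length, fun x ↦ ?_⟩, ?_⟩
  · rw [iterateFrobenius_def, ← hq]
  · have h1 : ((q ^ n + 1 : ℕ) : k) = 1 := by
      rw [Nat.cast_succ, ← hcard, FiniteField.cast_card_eq_zero, zero_add]
    haveI : NeZero ((q ^ n + 1 : ℕ) : k) := ⟨by rw [h1]; exact one_ne_zero⟩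
    obtain ⟨ζ, hζ⟩ := HasEnoughRootsOfUnity.exists_primitiveRoot (AlgebraicClosure k) (q ^ n + 1)
    exact ⟨(hζ.isUnit (Nat.succ_ne_zero _)).unit, hζ.isUnit_unit (Nat.succ_ne_zero _)⟩

/-! ### §2 p4's node theorems at a NON-SPLIT multiplicative place, presentation discharged -/

section Discharge

variable {F : Type u} [Field F] (X : WeierstrassCurve F) (L : Type u) [Field L] [Algebra F L]
  (R : Type*) [CommRing R] [IsDomain R] [IsDiscreteValuationRing R] [Algebra R L]
  [IsFractionRing R L] [(X.baseChange L).HasMultiplicativeReduction R]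
  [HenselianRing R (IsLocalRing.maximalIdeal R)] [Finite (IsLocalRing.ResidueField R)]
  (W₀ : WeierstrassCurve R) (hX : X.baseChange L = W₀.baseChange L)

omit [HenselianRing R (IsLocalRing.maximalIdeal R)] in
include hX in
/-- **The data of `h1red_of_nonsplit_node` at a NON-SPLIT multiplicative place, over `k̄`.** If
`X ⊗ L` has multiplicative but not split multiplicative reduction over `R` (`k` finite of order
`qⁿ`), then over `k̄ = AlgebraicClosure k` (`j = algebraMap`): the `R`-model reduces to a presented
node `singularModel x₀ y₀ α₁ α₂` with `α₁ ∉ j(k)`, the `q`-power map is a ring endomorphism, and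
there is a primitive `(qⁿ + 1)`-th root of unity. [cite: SilvermanAEC2009, VII.§5 (PDF p. 174)] -/
theorem exists_nonsplit_presentation_algebraicClosure
    (hns : ¬ (X.baseChange L).HasSplitMultiplicativeReduction R) {q n : ℕ}
    (hcard : Nat.card (IsLocalRing.ResidueField R) = q ^ n) :
    ∃ (x₀ y₀ α₁ α₂ : AlgebraicClosure (IsLocalRing.ResidueField R)),
      (W₀.map (IsLocalRing.residue R)).map
          (algebraMap (IsLocalRing.ResidueField R) (AlgebraicClosure (IsLocalRing.ResidueField R))) =
        singularModel x₀ y₀ α₁ α₂ ∧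
      α₁ ∉ Set.range (algebraMap (IsLocalRing.ResidueField R)
        (AlgebraicClosure (IsLocalRing.ResidueField R))) ∧
      (∃ Fq : AlgebraicClosure (IsLocalRing.ResidueField R) →+*
          AlgebraicClosure (IsLocalRing.ResidueField R), ∀ x, Fq x = x ^ q) ∧
      ∃ ζ : (AlgebraicClosure (IsLocalRing.ResidueField R))ˣ, IsPrimitiveRoot ζ (q ^ n + 1) := by
  haveI : Fintype (IsLocalRing.ResidueField R) := Fintype.ofFinite _
  have hcardF : Fintype.card (IsLocalRing.ResidueField R) = q ^ n := by
    rw [← Nat.card_eq_fintype_card, hcard]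
  set kb := AlgebraicClosure (IsLocalRing.ResidueField R)
  set j : IsLocalRing.ResidueField R →+* kb := algebraMap _ kb with hjdef
  obtain ⟨hΔ, hc⟩ := residue_Δ_eq_zero_and_residue_c₄_ne_zero_of_hasMultiplicativeReduction X L R W₀ hX
  -- Mathlib's splitting quadratic has a root in `k̄` (degree `2`: leading coefficient `c̄₄ ≠ 0`)
  set Q := (Polynomial.C W₀.c₄ * Polynomial.X ^ 2 + Polynomial.C (W₀.a₁ * W₀.c₄) * Polynomial.X -
      Polynomial.C (54 * W₀.b₆ - 3 * W₀.b₂ * W₀.b₄ + W₀.a₂ * W₀.c₄)).map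
        (algebraMap R (IsLocalRing.ResidueField R)) with hQdef
  have hc' : algebraMap R (IsLocalRing.ResidueField R) W₀.c₄ ≠ 0 := by
    rwa [IsLocalRing.ResidueField.algebraMap_eq]
  have hdeg : (Q.map j).degree ≠ 0 := by
    have h2 : (Q.map j).coeff 2 = j (algebraMap R (IsLocalRing.ResidueField R) W₀.c₄) := by
      rw [Polynomial.coeff_map]
      congr 1
      simp only [hQdef, Polynomial.map_sub, Polynomial.map_add, Polynomial.map_mul,
        Polynomial.map_pow, Polynomial.map_C, Polynomial.map_X, Polynomial.coeff_sub,
        Polynomial.coeff_add, Polynomial.coeff_C_mul, Polynomial.coeff_X_pow, Polynomial.coeff_C,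
        Polynomial.coeff_X, if_true]
      norm_num
    intro h0
    have hle : (Q.map j).degree < 2 := by rw [h0]; exact_mod_cast two_pos
    have := Polynomial.coeff_eq_zero_of_degree_lt hle
    rw [h2, map_eq_zero] at this
    exact hc' this
  obtain ⟨α, hα⟩ := IsAlgClosed.exists_root (Q.map j) hdeg
  obtain ⟨x₀, y₀, α₁, α₂, -, hW⟩ :=
    exists_map_map_residue_eq_singularModel_of_hasMultiplicativeReduction X L R W₀ hX j hα
  -- non-split: the quadratic does not split over `k`, so `α₁ ∉ j(k)`
  have hI : (X.baseChange L).integralModel R = W₀ := integralModel_eq_of_baseChange_eq X L R W₀ hX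
  have hnsQ : ¬ Q.Splits := fun hsplit ↦ hns
    { toHasMultiplicativeReduction := ‹_›
      splitMultiplicativeReduction := by rw [hI]; exact hsplit }
  have hα₁ := not_mem_range_of_not_splits R W₀ j hW hc hnsQ
  obtain ⟨hFq, hζ⟩ := exists_frobenius_and_primitiveRoot_algebraicClosure hcardF
  exact ⟨_, _, _, _, hW, hα₁, hFq, hζ⟩

include hX in
/-- **The `Ẽ_ns` half of (α) at a NON-SPLIT multiplicative place** — `h1red_of_nonsplit_node` with
`k' = k̄`, `j`, the presentation, `α₁ ∉ k`, `Fq`, `ζ` discharged from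
`[(X.baseChange L).HasMultiplicativeReduction R]` + `¬ HasSplitMultiplicativeReduction`; remaining
binders `hR`, `hcard`, `hfrob` by name (the non-split twin of p8's
`h1red_of_hasSplitMultiplicativeReduction`). [cite: SilvermanAEC2009, VII.2 Prop. 2.1, VII.§5,
Exercise 3.5(a)] [cite: SerreLocalFields1979, X §1 (Hilbert 90)] -/
theorem h1red_of_not_hasSplitMultiplicativeReduction
    (hns : ¬ (X.baseChange L).HasSplitMultiplicativeReduction R)
    (hR : ∀ (τ : L ≃ₐ[F] L) (x : L), x ∈ Set.range (algebraMap R L) →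
      τ x ∈ Set.range (algebraMap R L))
    (φ : L ≃ₐ[F] L) {q n : ℕ} (hcard : Nat.card (IsLocalRing.ResidueField R) = q ^ n)
    (hfrob : ∀ a : R, ∃ a' : R, algebraMap R L a' = φ (algebraMap R L a) ∧
      IsLocalRing.residue R a' = IsLocalRing.residue R a ^ q) :
    ∀ m ∈ (X.baseChange L).goodReductionSubgroup R, ∑ j ∈ Finset.range n, (φ ^ j) • m = 0 →
      ∃ c ∈ (X.baseChange L).goodReductionSubgroup R, m - (φ • c - c) ∈
        {Q : (X.baseChange L).toAffine.Point | ∀ (x y : L)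
          (h : (X.baseChange L).toAffine.Nonsingular x y), Q = .some x y h →
            x ∉ Set.range (algebraMap R L)} := by
  obtain ⟨_, _, _, _, hW, hα₁, ⟨Fq, hFq⟩, ζ, hζ⟩ :=
    exists_nonsplit_presentation_algebraicClosure X L R W₀ hX hns hcard
  exact h1red_of_nonsplit_node X L R W₀ hX _ hR hW hα₁ φ hcard hfrob Fq hFq hζ

include hX in
/-- **(α) from the formal-group stub alone, at a NON-SPLIT multiplicative place** —
`hα_of_h1ker_of_nonsplit_node` with the `k̄`-data discharged; remaining binders `hR`, `hφ`, `hn`,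
`hcard`, `hfrob` and the NAMED STUB `h1ker` (Milne *ADT* I.3.8 proof; x11b3-p4 S15 (i)).
[cite: MilneADT2006, Ch. I Prop. 3.8] [cite: SilvermanAEC2009, VII.2 Prop. 2.1, VII.§5, Exercise 3.5(a)] -/
theorem hα_of_h1ker_of_not_hasSplitMultiplicativeReduction
    (hns : ¬ (X.baseChange L).HasSplitMultiplicativeReduction R)
    (hR : ∀ (τ : L ≃ₐ[F] L) (x : L), x ∈ Set.range (algebraMap R L) →
      τ x ∈ Set.range (algebraMap R L))
    (φ : L ≃ₐ[F] L) (hφ : ∀ σ : L ≃ₐ[F] L, σ ∈ Subgroup.zpowers φ) {q n : ℕ} (hn : φ ^ n = 1)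
    (hcard : Nat.card (IsLocalRing.ResidueField R) = q ^ n)
    (hfrob : ∀ a : R, ∃ a' : R, algebraMap R L a' = φ (algebraMap R L a) ∧
      IsLocalRing.residue R a' = IsLocalRing.residue R a ^ q)
    (h1ker : ∀ m ∈ {Q : (X.baseChange L).toAffine.Point | ∀ (x y : L)
        (h : (X.baseChange L).toAffine.Nonsingular x y), Q = .some x y h →
          x ∉ Set.range (algebraMap R L)},
      ∑ j ∈ Finset.range n, (φ ^ j) • m = 0 →
        ∃ P ∈ {Q : (X.baseChange L).toAffine.Point | ∀ (x y : L)
          (h : (X.baseChange L).toAffine.Nonsingular x y), Q = .some x y h →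
            x ∉ Set.range (algebraMap R L)}, φ • P - P = m) :
    ∀ Q : (X.baseChange L).toAffine.Point,
      (∀ σ : L ≃ₐ[F] L, σ • Q - Q ∈ (X.baseChange L).goodReductionSubgroup R) →
        ∃ Q' : (X.baseChange L).toAffine.Point, (∀ σ : L ≃ₐ[F] L, σ • Q' = Q') ∧
          Q - Q' ∈ (X.baseChange L).goodReductionSubgroup R := by
  obtain ⟨_, _, _, _, hW, hα₁, ⟨Fq, hFq⟩, ζ, hζ⟩ :=
    exists_nonsplit_presentation_algebraicClosure X L R W₀ hX hns hcard
  exact hα_of_h1ker_of_nonsplit_node X L R W₀ hX _ hR hW hα₁ φ hφ hn hcard hfrob Fq hFq hζ h1ker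

include hX in
/-- **End form at `v` from the formal-group stub alone, at a NON-SPLIT multiplicative place** —
`exists_baseChange_eq_add_pow_smul_of_h1ker_of_nonsplit_node` with the `k̄`-data discharged:
`T = ι(t₀ + p^m t₁)`, `t₀ ∈ E₀(K_v)` (Jetchev Prop. 4.1 at `v`) modulo (a), (b), the cocycle,
`hR`/`hφ`/`hn`/`hcard`/`hfrob` and the ONE stub `h1ker`. [cite: Jetchev2008, Prop. 4.1 (p. 819)] -/
theorem exists_baseChange_eq_add_pow_smul_of_h1ker_of_not_hasSplitMultiplicativeReduction
    [IsGalois F L]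
    (R₀ : Type*) [CommRing R₀] [IsDomain R₀] [IsDiscreteValuationRing R₀] [Algebra R₀ F]
    [IsFractionRing R₀ F] [Algebra R₀ R] [Algebra R₀ L] [IsScalarTower R₀ R L]
    [IsScalarTower R₀ F L] [IsLocalHom (algebraMap R₀ R)] [(X.baseChange F).IsMinimal R₀]
    (hns : ¬ (X.baseChange L).HasSplitMultiplicativeReduction R)
    (hR : ∀ (τ : L ≃ₐ[F] L) (x : L), x ∈ Set.range (algebraMap R L) →
      τ x ∈ Set.range (algebraMap R L))
    (φ : L ≃ₐ[F] L) (hφ : ∀ σ : L ≃ₐ[F] L, σ ∈ Subgroup.zpowers φ) {q n : ℕ} (hn : φ ^ n = 1)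
    (hcard : Nat.card (IsLocalRing.ResidueField R) = q ^ n)
    (hfrob : ∀ a : R, ∃ a' : R, algebraMap R L a' = φ (algebraMap R L a) ∧
      IsLocalRing.residue R a' = IsLocalRing.residue R a ^ q)
    (h1ker : ∀ m ∈ {Q : (X.baseChange L).toAffine.Point | ∀ (x y : L)
        (h : (X.baseChange L).toAffine.Nonsingular x y), Q = .some x y h →
          x ∉ Set.range (algebraMap R L)},
      ∑ j ∈ Finset.range n, (φ ^ j) • m = 0 →
        ∃ P ∈ {Q : (X.baseChange L).toAffine.Point | ∀ (x y : L)
          (h : (X.baseChange L).toAffine.Nonsingular x y), Q = .some x y h →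
            x ∉ Set.range (algebraMap R L)}, φ • P - P = m)
    {p m n' : ℕ} (hcop : Nat.Coprime n' (p ^ m)) {U P T : (X.baseChange L).toAffine.Point}
    {Rσ : (L ≃ₐ[F] L) → (X.baseChange L).toAffine.Point}
    (hT : ∀ σ : L ≃ₐ[F] L, σ • T = T)
    (hP : (n' : ℤ) • P ∈ (X.baseChange L).goodReductionSubgroup R)
    (hRσ : ∀ σ : L ≃ₐ[F] L, (n' : ℤ) • Rσ σ ∈ (X.baseChange L).goodReductionSubgroup R)
    (hU : ∀ σ : L ≃ₐ[F] L, σ • U - U = Rσ σ) (hpU : ((p ^ m : ℕ) : ℤ) • U = P - T) :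
    ∃ t₀ t₁ : (X.baseChange F).toAffine.Point,
      t₀ ∈ (X.baseChange F).goodReductionSubgroup R₀ ∧
      T = Affine.Point.baseChange (W' := X.toAffine) F L (t₀ + ((p ^ m : ℕ) : ℤ) • t₁) := by
  obtain ⟨_, _, _, _, hW, hα₁, ⟨Fq, hFq⟩, ζ, hζ⟩ :=
    exists_nonsplit_presentation_algebraicClosure X L R W₀ hX hns hcard
  exact exists_baseChange_eq_add_pow_smul_of_h1ker_of_nonsplit_node X L R W₀ hX _ R₀ hR hW hα₁ φ
    hφ hn hcard hfrob Fq hFq hζ h1ker hcop hT hP hRσ hU hpU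

end Discharge

/-! ### §3 Over the complete layer: (α) with NO stub at a non-split multiplicative place -/

section Complete

open scoped NNReal

variable {F : Type u} [Field F] (X : WeierstrassCurve F) (L : Type u) [Field L] [Algebra F L]
  (R : Type*) [CommRing R] [IsDomain R] [IsDiscreteValuationRing R] [Algebra R L]
  [IsFractionRing R L] (w : Valuation L ℝ≥0) (hw : w.Integers R)
  [IsAdicComplete (IsLocalRing.maximalIdeal R) R] [Finite (IsLocalRing.ResidueField R)]
  [(X.baseChange L).IsElliptic] [(X.baseChange L).HasMultiplicativeReduction R]
  (W₀ : WeierstrassCurve R) (hX : X.baseChange L = W₀.baseChange L)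

include hw hX in
/-- **(α) of `JetchevKummerAtP` HOLDS — no stub — at a NON-SPLIT multiplicative place** over a
complete unramified layer: `R` the (adically complete) valuation ring of a rank-one valuation `w` on
`L` with finite residue field of order `qⁿ`, `X ⊗ L` elliptic with multiplicative, NOT split
multiplicative, reduction over `R`, `Gal(L/F) = ⟨φ⟩` with `φ` isometric (`hφw`), `φⁿ = 1`,
`φ` inducing `x ↦ x^q` on `k` (`hfrob`), all of `Gal` preserving `R` (`hR`), and a uniformiser of
`R` coming from `F` (`hϖ`, `hπ`: `L/F` unramified). Then every `Q ∈ E(L)` with all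
`σ Q − Q ∈ E₀(L)` is congruent modulo `E₀(L)` to a `Gal(L/F)`-fixed point. The formal-group half is
x11b3-p4's `h1ker_of_complete`, the `Ẽ_ns` half is `h1red_of_not_hasSplitMultiplicativeReduction`
(§2). The twin of p4's `hα_of_node_of_complete` (split / presented node). Nothing is booked;
`JET@p|N` is NOT discharged (inputs (a), (b), (c) + Jetchev §§5–7 remain).
[cite: MilneADT2006, Ch. I Prop. 3.8] [cite: SilvermanAEC2009, VII.2 Prop. 2.1–2.2, VII.§5,
Exercise 3.5(a)] [cite: SerreLocalFields1979, X §1 (Hilbert 90)] -/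
theorem hα_of_not_hasSplitMultiplicativeReduction_of_complete
    (hns : ¬ (X.baseChange L).HasSplitMultiplicativeReduction R)
    (hR : ∀ (τ : L ≃ₐ[F] L) (x : L), x ∈ Set.range (algebraMap R L) →
      τ x ∈ Set.range (algebraMap R L))
    (φ : L ≃ₐ[F] L) (hφ : ∀ σ : L ≃ₐ[F] L, σ ∈ Subgroup.zpowers φ) (hφw : ∀ x, w (φ x) = w x)
    {q n : ℕ} (hn : φ ^ n = 1) (hcard : Nat.card (IsLocalRing.ResidueField R) = q ^ n)
    (hfrob : ∀ a : R, ∃ a' : R, algebraMap R L a' = φ (algebraMap R L a) ∧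
      IsLocalRing.residue R a' = IsLocalRing.residue R a ^ q)
    {ϖ : R} (hϖ : Irreducible ϖ) {π : F} (hπ : algebraMap F L π = algebraMap R L ϖ) :
    ∀ Q : (X.baseChange L).toAffine.Point,
      (∀ σ : L ≃ₐ[F] L, σ • Q - Q ∈ (X.baseChange L).goodReductionSubgroup R) →
        ∃ Q' : (X.baseChange L).toAffine.Point, (∀ σ : L ≃ₐ[F] L, σ • Q' = Q') ∧
          Q - Q' ∈ (X.baseChange L).goodReductionSubgroup R :=
  hα_of_h1ker_of_not_hasSplitMultiplicativeReduction X L R W₀ hX hns hR φ hφ hn hcard hfrob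
    (h1ker_of_complete X L R w hw W₀ hX hR φ hφw hn hcard hfrob hϖ hπ)

include hw hX in
/-- **Jetchev's Prop. 4.1 at a NON-SPLIT multiplicative place `v`, modulo p1's inputs (a), (b) and
the cocycle ONLY**: `T = ι(t₀ + p^m t₁)` with `t₀ ∈ E₀(K_v)`, i.e. `T ∈ E₀(K_v) + p^m E(K_v)`. (α)
and `hstab` of `JetchevKummerAtP` are discharged here (twin of p4's
`exists_baseChange_eq_add_pow_smul_of_node_of_complete`); the flag `JET@p|N` is NOT.
[cite: Jetchev2008, Prop. 4.1 (p. 819)] [cite: GrossLMS1991, Prop. 6.2 (1), pp. 244–245]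
[cite: MilneADT2006, Ch. I Prop. 3.8] -/
theorem exists_baseChange_eq_add_pow_smul_of_not_hasSplitMultiplicativeReduction_of_complete
    [IsGalois F L]
    (R₀ : Type*) [CommRing R₀] [IsDomain R₀] [IsDiscreteValuationRing R₀] [Algebra R₀ F]
    [IsFractionRing R₀ F] [Algebra R₀ R] [Algebra R₀ L] [IsScalarTower R₀ R L]
    [IsScalarTower R₀ F L] [IsLocalHom (algebraMap R₀ R)] [(X.baseChange F).IsMinimal R₀]
    (hns : ¬ (X.baseChange L).HasSplitMultiplicativeReduction R)
    (hR : ∀ (τ : L ≃ₐ[F] L) (x : L), x ∈ Set.range (algebraMap R L) →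
      τ x ∈ Set.range (algebraMap R L))
    (φ : L ≃ₐ[F] L) (hφ : ∀ σ : L ≃ₐ[F] L, σ ∈ Subgroup.zpowers φ) (hφw : ∀ x, w (φ x) = w x)
    {q n : ℕ} (hn : φ ^ n = 1) (hcard : Nat.card (IsLocalRing.ResidueField R) = q ^ n)
    (hfrob : ∀ a : R, ∃ a' : R, algebraMap R L a' = φ (algebraMap R L a) ∧
      IsLocalRing.residue R a' = IsLocalRing.residue R a ^ q)
    {ϖ : R} (hϖ : Irreducible ϖ) {π : F} (hπ : algebraMap F L π = algebraMap R L ϖ)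
    {p m n' : ℕ} (hcop : Nat.Coprime n' (p ^ m)) {U P T : (X.baseChange L).toAffine.Point}
    {Rσ : (L ≃ₐ[F] L) → (X.baseChange L).toAffine.Point}
    (hT : ∀ σ : L ≃ₐ[F] L, σ • T = T)
    (hP : (n' : ℤ) • P ∈ (X.baseChange L).goodReductionSubgroup R)
    (hRσ : ∀ σ : L ≃ₐ[F] L, (n' : ℤ) • Rσ σ ∈ (X.baseChange L).goodReductionSubgroup R)
    (hU : ∀ σ : L ≃ₐ[F] L, σ • U - U = Rσ σ) (hpU : ((p ^ m : ℕ) : ℤ) • U = P - T) :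
    ∃ t₀ t₁ : (X.baseChange F).toAffine.Point,
      t₀ ∈ (X.baseChange F).goodReductionSubgroup R₀ ∧
      T = Affine.Point.baseChange (W' := X.toAffine) F L (t₀ + ((p ^ m : ℕ) : ℤ) • t₁) :=
  exists_baseChange_eq_add_pow_smul X L R₀ R
    (fun σ _ hQ ↦ smul_mem_goodReductionSubgroup X L R hR σ hQ)
    (hα_of_not_hasSplitMultiplicativeReduction_of_complete X L R w hw W₀ hX hns hR φ hφ hφw hn
      hcard hfrob hϖ hπ)
    hcop hT hP hRσ hU hpU

end Complete

end Summit.BirchSwinnertonDyer.Rank1Residual.X11b.Three.JetchevKummer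

end
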